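import Literature.Geometry.GeometricMeasureTheory.RectifiableFrameRank
import Mathlib.Analysis.Calculus.LocalExtr.Basic
import Mathlib.Analysis.Normed.Module.Dual
import HarnessLib

/-!
# Approximate tangent cones of rectifiable sets and of `C¹` level sets

Two elementary complements to Federer's theory of approximate tangent cones
`Tan^m(μ, x) = ⋂ {Tan(S, x) : Θ^{*m}(μ ⌞ Sᶜ, x) = 0}` (`approxTangentCone` of `Currents.lean`,
[Federer1969, 3.2.16]) for `μ = 𝓗^m ⌞ W`, used to identify the approximate tangent planes of the
regular part of an analytic set (`Literature/Geometry/Kaehler/HolomorphicChainRectifiable*.lean`):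

* `approxTangentCone_subset_ker_of_levelSet` — **upper bound at a level-set point**: if near `x`
  the (measurable) set `W` lies in the level set `{g = g x}` of a map `g` differentiable at `x`,
  then `Tan^m(𝓗^m ⌞ W, x) ⊆ ker Dg(x)`. Proof: `S = W ∩ U` is admissible (the measure
  `𝓗^m ⌞ W ⌞ Sᶜ` vanishes near `x`), and every `ℓ ∘ g`, `ℓ ∈ F*`, is constant on `S`, so
  `ℓ (Dg(x) v) ≤ 0` and `≥ 0` for `v ∈ Tan(S, x)` (Mathlib's
  `IsLocalMaxOn.hasFDerivWithinAt_nonpos`), i.e. `Dg(x) v = 0` (Hahn–Banach).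
* `ae_exists_subspace_subset_approxTangentCone` — **lower bound, almost everywhere**: if `W` is
  measurable and countably `m`-rectifiable then for `𝓗^m ⌞ W`-a.e. `x` the cone
  `Tan^m(𝓗^m ⌞ W, x)` contains an `m`-dimensional linear subspace (the image of the differential
  of a Lipschitz parametrisation, [Federer1969, 3.2.19], via the tree's
  `fderiv_apply_mem_posTangentConeAt_ae` and the Sard-type lemma
  `hausdorffMeasure_image_null_of_fderiv_not_injective`).
* `approxTangentCone_eq_of_sandwich` — hence, at a.e. point of an `m`-rectifiable set lying
  locally in level sets of submersions with `m`-dimensional kernels, the approximate tangent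
  cone IS the kernel (an `m`-plane): `L ⊆ Tan ⊆ K` with `dim L = dim K` forces `Tan = K`.

Everything is proved from Mathlib and the tree; no definitions, no named facts.

## References

* H. Federer, *Geometric Measure Theory*, Springer 1969, 3.2.16, 3.2.19 [Federer1969].
-/

noncomputable section

open MeasureTheory MeasureTheory.Measure Set Function Filter Metric Module
open scoped ENNReal NNReal Topology

namespace Literature.Geometry.GeometricMeasureTheory

variable {V : Type*} [NormedAddCommGroup V] [NormedSpace ℝ V] [MeasurableSpace V] [BorelSpace V]

/-! ### Upper bound: level sets -/

section LevelSet

omit [NormedSpace ℝ V] [BorelSpace V] in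
/-- A measure vanishing on the small closed balls around `x` has upper density `0` at `x`.
[cite: Federer1969, 2.10.19] -/
theorem upperDensity_eq_zero_of_eventually_measure_closedBall (m : ℕ) {μ : Measure V} {x : V}
    (h : ∀ᶠ r in 𝓝[>] (0 : ℝ), μ (closedBall x r) = 0) : upperDensity m μ x = 0 := by
  unfold upperDensity
  have h' : ∀ᶠ r in 𝓝[>] (0 : ℝ),
      μ (closedBall x r) / (unitBallVolume m * ENNReal.ofReal (r ^ m)) = (0 : ℝ≥0∞) := by
    filter_upwards [h] with r hr
    rw [hr, ENNReal.zero_div]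
  rw [limsup_congr h']
  exact limsup_const 0

/-- **Approximate tangent vectors at a level-set point are tangent to the level set.** Let
`W ⊆ V` be measurable and suppose that on a neighbourhood `U` of `x` the set `W` lies in the level
set `{g = g x}` of a map `g : V → F` with Fréchet derivative `g'` at `x`. Then
`Tan^m(𝓗^m ⌞ W, x) ⊆ ker g'`: with the admissible set `S = W ∩ U` (`𝓗^m ⌞ W ⌞ Sᶜ` vanishes near
`x`), each `ℓ ∘ g` (`ℓ ∈ F*`) is constant on `S`, hence has a local maximum and a local minimum on
`S` at `x`, so `ℓ (g' v) = 0` for `v ∈ Tan(S, x)`. [cite: Federer1969, 3.2.16] -/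
theorem approxTangentCone_subset_ker_of_levelSet {m : ℕ} {W : Set V} (hW : MeasurableSet W)
    {x : V} {U : Set V} (hU : U ∈ 𝓝 x) {F : Type*} [NormedAddCommGroup F] [NormedSpace ℝ F]
    {g : V → F} {g' : V →L[ℝ] F} (hg : HasFDerivAt g g' x) (hlevel : ∀ y ∈ W ∩ U, g y = g x) :
    approxTangentCone m ((μHE[m] : Measure V).restrict W) x ⊆
      (LinearMap.ker (g' : V →ₗ[ℝ] F) : Set V) := by
  -- an open neighbourhood inside `U`
  obtain ⟨r₀, hr₀, hball⟩ := Metric.mem_nhds_iff.1 hU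
  set S : Set V := W ∩ ball x r₀ with hS
  have hSm : MeasurableSet S := hW.inter measurableSet_ball
  -- `S` is admissible: `𝓗^m ⌞ W ⌞ Sᶜ` vanishes on `closedBall x r` for `r < r₀`
  have hdens : upperDensity m ((((μHE[m] : Measure V).restrict W)).restrict Sᶜ) x = 0 := by
    refine upperDensity_eq_zero_of_eventually_measure_closedBall m ?_
    filter_upwards [Ioo_mem_nhdsGT hr₀] with r hr
    rw [Measure.restrict_apply measurableSet_closedBall,
      Measure.restrict_apply (measurableSet_closedBall.inter hSm.compl)]
    have : closedBall x r ∩ Sᶜ ∩ W = ∅ := by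
      refine eq_empty_iff_forall_notMem.2 fun y hy => hy.1.2 ⟨hy.2, ?_⟩
      exact closedBall_subset_ball hr.2 hy.1.1
    rw [this, measure_empty]
  intro v hv
  have hvS : v ∈ posTangentConeAt S x := (mem_iInter₂.1 hv) S hdens
  -- every functional kills `g' v`
  have hzero : ∀ ℓ : StrongDual ℝ F, ℓ (g' v) = 0 := by
    intro ℓ
    have hderiv : HasFDerivWithinAt (fun y => ℓ (g y)) (ℓ.comp g') S x :=
      (ℓ.hasFDerivAt.comp x hg).hasFDerivWithinAt
    have hconst : ∀ y ∈ S, ℓ (g y) = ℓ (g x) := fun y hy =>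
      congrArg ℓ (hlevel y ⟨hy.1, hball hy.2⟩)
    have hmax : IsLocalMaxOn (fun y => ℓ (g y)) S x :=
      eventually_nhdsWithin_of_forall fun y hy => (hconst y hy).le
    have hmin : IsLocalMinOn (fun y => ℓ (g y)) S x :=
      eventually_nhdsWithin_of_forall fun y hy => (hconst y hy).ge
    have h1 : (ℓ.comp g') v ≤ 0 := hmax.hasFDerivWithinAt_nonpos hderiv hvS
    have h2 : 0 ≤ (ℓ.comp g') v := hmin.hasFDerivWithinAt_nonneg hderiv hvS
    exact le_antisymm h1 h2
  exact SeparatingDual.eq_zero_of_forall_dual_eq_zero hzero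

end LevelSet

/-! ### Lower bound: rectifiable sets, almost everywhere -/

section Rectifiable

variable [FiniteDimensional ℝ V]

/-- **At almost every point of a countably `m`-rectifiable set the approximate tangent cone
contains an `m`-plane.** For `W ⊆ V` measurable and countably `m`-rectifiable and
`μ = 𝓗^m ⌞ W`, for `μ`-a.e. `x` there is a linear subspace `L` of dimension `m` with
`L ⊆ Tan^m(μ, x)` — namely the image of the (injective) differential of a Lipschitz
parametrisation through `x`; the parameters where the parametrisation is not differentiable, or
the inclusion `im Dg(u) ⊆ Tan^m` of 3.2.19 fails, or `Dg(u)` is not injective, have `𝓗^m`-null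
image. [cite: Federer1969, 3.2.19] -/
theorem ae_exists_subspace_subset_approxTangentCone {m : ℕ} {W : Set V} (hWm : MeasurableSet W)
    (hWr : IsCountablyRectifiable m W) :
    ∀ᵐ x ∂((μHE[m] : Measure V).restrict W), ∃ L : Submodule ℝ V,
      Module.finrank ℝ L = m ∧
        (L : Set V) ⊆ approxTangentCone m ((μHE[m] : Measure V).restrict W) x := by
  classical
  set μ : Measure V := (μHE[m] : Measure V).restrict W with hμ
  -- the normalisation constant `μHE[m] = c • μH[m]`
  set c : ℝ≥0∞ := (addHaarScalarFactor (volume : Measure (EuclideanSpace ℝ (Fin m)))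
    (μH[m] : Measure (EuclideanSpace ℝ (Fin m))) : ℝ≥0∞) with hc_def
  have hc0 : c ≠ 0 := by
    rw [hc_def, Ne, ENNReal.coe_eq_zero]
    exact Measure.addHaarScalarFactor_volume_hausdorffMeasure_ne_zero m
  have hctop : c ≠ ⊤ := ENNReal.coe_ne_top
  have hHE : (μHE[m] : Measure V) = c • (μH[m] : Measure V) := by
    rw [Measure.euclideanHausdorffMeasure_def, hc_def, ENNReal.smul_def]
  have hHE0 : ∀ s : Set V, (μH[m] : Measure V) s = 0 → μ s = 0 := by
    intro s hs
    rw [hμ]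
    refine nonpos_iff_eq_zero.1 ((Measure.le_iff'.1 Measure.restrict_le_self s).trans ?_)
    rw [hHE, Measure.smul_apply, hs, smul_zero]
  -- Lipschitz parametrisations by `ℝᵐ = Fin m → ℝ`
  obtain ⟨f, hf, hcov⟩ := hWr
  let e := EuclideanSpace.equiv (Fin m) ℝ
  let g : ℕ → (Fin m → ℝ) → V := fun i => f i ∘ e.symm
  have hg : ∀ i, ∃ L : ℝ≥0, LipschitzWith L (g i) := fun i => by
    obtain ⟨K, hK⟩ := hf i
    exact ⟨_, hK.comp (e.symm : (Fin m → ℝ) →L[ℝ] EuclideanSpace ℝ (Fin m)).lipschitz⟩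
  have hrange : ∀ i, range (g i) = range (f i) := fun i => by
    ext x
    constructor
    · rintro ⟨u, rfl⟩
      exact ⟨e.symm u, rfl⟩
    · rintro ⟨y, rfl⟩
      exact ⟨e y, by simp [g]⟩
  have hcovμ : ∀ᵐ x ∂μ, x ∈ ⋃ i, range (g i) := by
    have h1 : μ (⋃ i, range (g i))ᶜ = 0 := by
      rw [hμ, Measure.restrict_apply' hWm]
      have : (⋃ i, range (g i))ᶜ ∩ W = W \ ⋃ i, range (f i) := by
        rw [sdiff_eq, inter_comm, iUnion_congr hrange]
      rw [this]
      exact hcov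
    filter_upwards [measure_eq_zero_iff_ae_notMem.1 h1] with x hx
    simpa using hx
  have hWμ : ∀ᵐ x ∂μ, x ∈ W := ae_restrict_mem hWm
  -- reduction to one parametrisation
  suffices H : ∀ i, ∀ᵐ x ∂μ, x ∈ range (g i) → x ∈ W →
      ∃ L : Submodule ℝ V, Module.finrank ℝ L = m ∧ (L : Set V) ⊆ approxTangentCone m μ x by
    have H' := ae_all_iff.2 H
    filter_upwards [H', hcovμ, hWμ] with x hx hxU hxW
    obtain ⟨i, hi⟩ := mem_iUnion.1 hxU
    exact hx i hi hxW
  intro i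
  obtain ⟨L, hL⟩ := hg i
  have hjc : Fintype.card (Fin m) = m := Fintype.card_fin m
  have hvol : (μH[m] : Measure (Fin m → ℝ)) = volume := by
    have := hausdorffMeasure_pi_real (ι := Fin m)
    rwa [hjc] at this
  -- the Lebesgue-null exceptional parameter sets
  have h1 : ∀ᵐ u ∂(volume : Measure (Fin m → ℝ)), DifferentiableAt ℝ (g i) u :=
    hL.ae_differentiableAt
  have h2 : ∀ᵐ u ∂(volume : Measure (Fin m → ℝ)), g i u ∈ W → DifferentiableAt ℝ (g i) u →
      Injective (fderiv ℝ (g i) u) → ∀ S : Set V,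
        upperDensity m (((μH[m] : Measure V).restrict W).restrict Sᶜ) (g i u) = 0 →
        ∀ v, fderiv ℝ (g i) u v ∈ posTangentConeAt S (g i u) := by
    have := fderiv_apply_mem_posTangentConeAt_ae hL hWm
    rwa [hjc] at this
  set E : Set (Fin m → ℝ) := {u | ¬ (DifferentiableAt ℝ (g i) u ∧
      (g i u ∈ W → DifferentiableAt ℝ (g i) u → Injective (fderiv ℝ (g i) u) → ∀ S : Set V,
        upperDensity m (((μH[m] : Measure V).restrict W).restrict Sᶜ) (g i u) = 0 →
        ∀ v, fderiv ℝ (g i) u v ∈ posTangentConeAt S (g i u)))} with hE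
  have hE0 : volume E = 0 := by
    have : ∀ᵐ u ∂(volume : Measure (Fin m → ℝ)), DifferentiableAt ℝ (g i) u ∧
        (g i u ∈ W → DifferentiableAt ℝ (g i) u → Injective (fderiv ℝ (g i) u) → ∀ S : Set V,
          upperDensity m (((μH[m] : Measure V).restrict W).restrict Sᶜ) (g i u) = 0 →
          ∀ v, fderiv ℝ (g i) u v ∈ posTangentConeAt S (g i u)) := by
      filter_upwards [h1, h2] with u h1 h2 using ⟨h1, h2⟩
    exact ae_iff.1 this
  set Z : Set (Fin m → ℝ) := {u | DifferentiableAt ℝ (g i) u ∧ ¬ Injective (fderiv ℝ (g i) u)}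
    with hZ
  have hZ0 : (μH[m] : Measure V) (g i '' Z) = 0 := by
    have := Literature.Analysis.Calculus.hausdorffMeasure_image_null_of_fderiv_not_injective hL
    rwa [hjc] at this
  have hE0' : (μH[m] : Measure V) (g i '' E) = 0 := by
    refine nonpos_iff_eq_zero.1 ((hL.hausdorffMeasure_image_le (Nat.cast_nonneg m) E).trans ?_)
    rw [hvol, hE0, mul_zero]
  have hbad : ∀ᵐ x ∂μ, x ∉ g i '' (E ∪ Z) := by
    refine measure_eq_zero_iff_ae_notMem.1 (hHE0 _ ?_)
    rw [image_union]
    exact measure_union_null hE0' hZ0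
  -- the pointwise argument
  filter_upwards [hbad] with x hx hxr hxW
  obtain ⟨u, rfl⟩ := hxr
  have huE : u ∉ E := fun h => hx (mem_image_of_mem _ (Or.inl h))
  have huZ : u ∉ Z := fun h => hx (mem_image_of_mem _ (Or.inr h))
  simp only [hE, mem_setOf_eq, not_not] at huE
  obtain ⟨hdiff, hT⟩ := huE
  have hinj : Injective (fderiv ℝ (g i) u) := by
    by_contra h
    exact huZ ⟨hdiff, h⟩
  set T := fderiv ℝ (g i) u with hT_def
  refine ⟨LinearMap.range (T : (Fin m → ℝ) →ₗ[ℝ] V), ?_, ?_⟩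
  · rw [LinearMap.finrank_range_of_inj hinj, finrank_fin_fun]
  · rintro _ ⟨v, rfl⟩
    refine mem_iInter₂.2 fun S hS => hT hxW hdiff hinj S ?_ v
    -- the upper densities for `μ` and for `μH[m] ⌞ W` vanish together
    have e1 : μ.restrict Sᶜ = c • (((μH[m] : Measure V).restrict W).restrict Sᶜ) := by
      rw [hμ, hHE, Measure.restrict_smul, Measure.restrict_smul]
    rw [e1, upperDensity_smul _ _ _ hctop, mul_eq_zero] at hS
    exact hS.resolve_left hc0

end Rectifiable

/-! ### Sandwich -/

omit [MeasurableSpace V] [BorelSpace V] in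
/-- **Sandwich.** If a set `C` (an approximate tangent cone) contains a subspace `L` and is
contained in a subspace `K` with `dim K ≤ dim L < ∞`, then `C = K`. [folklore] -/
theorem eq_of_subspace_sandwich {C : Set V} {L K : Submodule ℝ V} [FiniteDimensional ℝ K]
    (hL : (L : Set V) ⊆ C) (hK : C ⊆ K) (h : Module.finrank ℝ K ≤ Module.finrank ℝ L) :
    C = K := by
  have hLK : L ≤ K := fun v hv => hK (hL hv)
  have hEq : L = K := Submodule.eq_of_le_of_finrank_le hLK h
  exact Subset.antisymm hK (hEq ▸ hL)

/-- **The approximate tangent cone at a good point is the tangent plane.** If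
`Tan^m(𝓗^m ⌞ W, x)` contains an `m`-dimensional subspace and, near `x`, `W` lies in a level set of
a map `g` differentiable at `x` whose derivative has an `m`-dimensional kernel, then
`Tan^m(𝓗^m ⌞ W, x) = ker Dg(x)`. [cite: Federer1969, 3.2.16, 3.2.19] -/
theorem approxTangentCone_eq_ker_of_levelSet [FiniteDimensional ℝ V] {m : ℕ} {W : Set V}
    (hW : MeasurableSet W) {x : V} {U : Set V} (hU : U ∈ 𝓝 x) {F : Type*} [NormedAddCommGroup F]
    [NormedSpace ℝ F] {g : V → F} {g' : V →L[ℝ] F} (hg : HasFDerivAt g g' x)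
    (hlevel : ∀ y ∈ W ∩ U, g y = g x) (hker : Module.finrank ℝ (LinearMap.ker (g' : V →ₗ[ℝ] F)) = m)
    (hL : ∃ L : Submodule ℝ V, Module.finrank ℝ L = m ∧
      (L : Set V) ⊆ approxTangentCone m ((μHE[m] : Measure V).restrict W) x) :
    approxTangentCone m ((μHE[m] : Measure V).restrict W) x =
      (LinearMap.ker (g' : V →ₗ[ℝ] F) : Set V) := by
  obtain ⟨L, hLm, hLC⟩ := hL
  exact eq_of_subspace_sandwich hLC (approxTangentCone_subset_ker_of_levelSet hW hU hg hlevel)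
    (by rw [hker, hLm])

end Literature.Geometry.GeometricMeasureTheory
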